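import Summits.CriticalPhenomena.PercolationContinuityZ3.Theorems.PercNearOneGluingNoHeavyConstsClusterSquareSeparated
import HarnessLib

/-!
# CSQ, DUU and TS when branch vertices are separated (`Fin n` forms)

builds on p205010 (kernel theorem, internal audit signed; external expert review pending)

PAPER-2 track "percolation constants", part (ii), seat `prim-consts-1`, gen 17 (lane index
`run/shared/lean/prim/consts/CONSTANTS.md`, row A19; memo `FROM-prim-consts-1-g17-THREE-COPY-STRUCTURE.md` §2).
Support file for the crux `NoHeavyLowerTail` (stmt-CriticalPhenomena-4575; `--supports`).  Theorems only; no sorries.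

`Fin n` forms (CSQ, DUU at `(a; b, c)`, TS for `{a, b, c}`) of the combinatorial criterion proved in `…ConstsClusterSquareSeparated.lean`
for the no-double-clash hypothesis of `…ConstsClusterSquareNDCPos.lean`, subsuming
`…ConstsClusterSquareNDC.lean` (at most four vertices) and `…ConstsClusterSquareThin.lean` (a thinly attached terminal).
Terminology (relative to a graph `H` carrying all pairs of positive weight and the terminals `a, b, c`): a *branch vertex* is a
vertex outside `{a, b, c}` with at least three neighbours; a set of vertices is *closed off `A`* if it is closed under `H`-steps into
vertices outside `A`; `R_t` denotes any set containing `t` and closed off `{a, b, c}`.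
**A `b`-clash forces a branch vertex `v ∈ R_a ∩ R_b ∩ R_c` joined to `b` in `ω` and to `c` in `η'`**
(`Consts.exists_branch_of_clash`): the `η'`-path `Q` from the clash vertex `y` to `c` (inside `C_c(η')`, avoiding `K ∪ {b}`) must
leave the `ω`-path `P` from `y` to `b` (inside `C_b(ω)`, avoiding `K ∪ {c}`) at a vertex `v ≠ b` of `P`; `v` has three distinct
neighbours (its predecessor on `P` or in `K`, its successor on `P`, the exit vertex), lies on `P` and on `Q`, and is reached through
vertices outside `{a, b, c}` from `b` (backwards along `P`), from `c` (backwards along `Q`) and from `a` (through `K`, the pair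
`{k, y}` and `P`).  Symmetrically a `c`-clash forces a branch vertex `v' ∈ R_a ∩ R_b ∩ R_c` joined to `c` in `ω` and to `b` in `η'`;
as `b ↮ c` in both configurations, `v ≠ v'`, the `ω`-path from `v` to `b` avoids `{a, c, v'}`, the `η'`-path from `v` to `c` avoids
`{a, b, v'}`, and likewise for `v'`.  Hence (`Consts.not_doubleClash_of_separated`) **no double clash occurs if for every ordered pair
of distinct branch vertices `v, v' ∈ R_a ∩ R_b ∩ R_c` one of the four separations holds: `v ∤ b` off `{a, c, v'}`, `v ∤ c` off
`{a, b, v'}`, `v' ∤ c` off `{a, b, v}`, `v' ∤ b` off `{a, c, v}`** — each certified by a closed set containing the one vertex and not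
the other.  CSQ, DUU at `(a; b, c)` and TS for `{a, b, c}` follow (`Consts.clusterSquare_le_sq_of_separated`, `…_of_separated`), in
particular when `R_a ∩ R_b ∩ R_c` has at most one branch vertex (`…_of_oneBranch`) and when at most one vertex outside `{a, b, c}`
has three or more neighbours at all (`Consts.tripleSplit_of_atMostOneBranch`; contains `n ≤ 4` and "degree ≤ 2 outside the
terminals").  Exhaustive check (lane engine `eng/branch_crit.py`): the criterion holds for 19 770 of the 20 010 rooted graphs on five
vertices with at most seven edges satisfying NDC, and for none violating it.
Reference: N. Gladkov, arXiv:2408.08457v2 (2024), Thm. 4.3, Def. 4.2, Lemma 3.1, Example 2.5, Thm. 5.2.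
-/

noncomputable section

open Classical

namespace Summit.CriticalPhenomena.PercolationContinuityZ3.Theorems

open MeasureTheory Finset Literature.Probability.LatticeModels Literature.Probability.Percolation
open Literature.Probability.Percolation.DecisionTree Literature.Probability.Percolation.BHK2006
open Literature.Probability.Percolation.TargetExploration Literature.Probability.Percolation.ClusterConditioning

namespace Consts

/-! ### `Fin n` forms -/

section Fin

variable {n : ℕ} (w : Sym2 (Fin n) → unitInterval) (a b c : Fin n) (H : SimpleGraph (Fin n)) [DecidableRel H.Adj]

/-- **CSQ at `(a; b, c)` when every pair of branch vertices of `R_a ∩ R_b ∩ R_c` is separated** (hypotheses as in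
`Consts.not_doubleClash_of_separated`): `clusterSquare w a b c ≤ μ(b ↮ c)²`. [cite: Gladkov2024, Thm. 4.3, Def. 4.2, Lemma 3.1, Ex. 2.5] -/
theorem clusterSquare_le_sq_of_separated (hH : ∀ u v, u ≠ v → (0 : ℝ) < w s(u, v) → H.Adj u v)
    (Ra Rb Rc : Set (Fin n)) (haR : a ∈ Ra) (hbR : b ∈ Rb) (hcR : c ∈ Rc)
    (hRa : ∀ u v, u ∈ Ra → H.Adj u v → v ≠ a → v ≠ b → v ≠ c → v ∈ Ra)
    (hRb : ∀ u v, u ∈ Rb → H.Adj u v → v ≠ a → v ≠ b → v ≠ c → v ∈ Rb)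
    (hRc : ∀ u v, u ∈ Rc → H.Adj u v → v ≠ a → v ≠ b → v ≠ c → v ∈ Rc)
    (hsep : ∀ v v', v ∈ Ra → v ∈ Rb → v ∈ Rc → v' ∈ Ra → v' ∈ Rb → v' ∈ Rc → v ≠ a → v ≠ b → v ≠ c →
      v' ≠ a → v' ≠ b → v' ≠ c → v ≠ v' → 3 ≤ H.degree v → 3 ≤ H.degree v' → ∃ S : Set (Fin n),
        (v ∈ S ∧ b ∉ S ∧ ∀ u x, u ∈ S → H.Adj u x → x ≠ a → x ≠ c → x ≠ v' → x ∈ S) ∨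
        (v ∈ S ∧ c ∉ S ∧ ∀ u x, u ∈ S → H.Adj u x → x ≠ a → x ≠ b → x ≠ v' → x ∈ S) ∨
        (v' ∈ S ∧ c ∉ S ∧ ∀ u x, u ∈ S → H.Adj u x → x ≠ a → x ≠ b → x ≠ v → x ∈ S) ∨
        (v' ∈ S ∧ b ∉ S ∧ ∀ u x, u ∈ S → H.Adj u x → x ≠ a → x ≠ c → x ≠ v → x ∈ S)) :
    clusterSquare w a b c ≤ (prodBernoulli w).real (openConn b c)ᶜ ^ 2 :=
  clusterSquare_le_sq_of_noDoubleClash_pos w a b c fun _ _ hω hη hab hac hbc hbc' =>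
    not_doubleClash_of_separated H w hH Ra Rb Rc haR hbR hcR hRa hRb hRc hsep hω hη hab hac hbc hbc'

/-- **DUU at `(a; b, c)` when every pair of branch vertices of `R_a ∩ R_b ∩ R_c` is separated.** [cite: Gladkov2024, Thm. 5.2, Thm. 4.3] -/
theorem sq_real_split_le_of_separated (hH : ∀ u v, u ≠ v → (0 : ℝ) < w s(u, v) → H.Adj u v)
    (Ra Rb Rc : Set (Fin n)) (haR : a ∈ Ra) (hbR : b ∈ Rb) (hcR : c ∈ Rc)
    (hRa : ∀ u v, u ∈ Ra → H.Adj u v → v ≠ a → v ≠ b → v ≠ c → v ∈ Ra)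
    (hRb : ∀ u v, u ∈ Rb → H.Adj u v → v ≠ a → v ≠ b → v ≠ c → v ∈ Rb)
    (hRc : ∀ u v, u ∈ Rc → H.Adj u v → v ≠ a → v ≠ b → v ≠ c → v ∈ Rc)
    (hsep : ∀ v v', v ∈ Ra → v ∈ Rb → v ∈ Rc → v' ∈ Ra → v' ∈ Rb → v' ∈ Rc → v ≠ a → v ≠ b → v ≠ c →
      v' ≠ a → v' ≠ b → v' ≠ c → v ≠ v' → 3 ≤ H.degree v → 3 ≤ H.degree v' → ∃ S : Set (Fin n),
        (v ∈ S ∧ b ∉ S ∧ ∀ u x, u ∈ S → H.Adj u x → x ≠ a → x ≠ c → x ≠ v' → x ∈ S) ∨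
        (v ∈ S ∧ c ∉ S ∧ ∀ u x, u ∈ S → H.Adj u x → x ≠ a → x ≠ b → x ≠ v' → x ∈ S) ∨
        (v' ∈ S ∧ c ∉ S ∧ ∀ u x, u ∈ S → H.Adj u x → x ≠ a → x ≠ b → x ≠ v → x ∈ S) ∨
        (v' ∈ S ∧ b ∉ S ∧ ∀ u x, u ∈ S → H.Adj u x → x ≠ a → x ≠ c → x ≠ v → x ∈ S)) :
    (prodBernoulli w).real ((openConn a b)ᶜ ∩ (openConn a c)ᶜ ∩ (openConn b c)ᶜ) ^ 2 ≤
      (prodBernoulli w).real ((openConn a b)ᶜ ∩ (openConn a c)ᶜ) * (prodBernoulli w).real (openConn b c)ᶜ ^ 2 :=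
  sq_real_split_le_of_noDoubleClash_pos w a b c fun _ _ hω hη hab hac hbc hbc' =>
    not_doubleClash_of_separated H w hH Ra Rb Rc haR hbR hcR hRa hRb hRc hsep hω hη hab hac hbc hbc'

/-- **TS for `{a, b, c}` when every pair of branch vertices of `R_a ∩ R_b ∩ R_c` is separated** (root `a`):
`μ(a ↮ b, a ↮ c, b ↮ c)² ≤ μ(a ↮ b) μ(a ↮ c) μ(b ↮ c)`. [cite: Gladkov2024, Thm. 5.2, Cor. 5.3 (pattern) and Thm. 4.3] -/
theorem tripleSplit_of_separated (hH : ∀ u v, u ≠ v → (0 : ℝ) < w s(u, v) → H.Adj u v)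
    (Ra Rb Rc : Set (Fin n)) (haR : a ∈ Ra) (hbR : b ∈ Rb) (hcR : c ∈ Rc)
    (hRa : ∀ u v, u ∈ Ra → H.Adj u v → v ≠ a → v ≠ b → v ≠ c → v ∈ Ra)
    (hRb : ∀ u v, u ∈ Rb → H.Adj u v → v ≠ a → v ≠ b → v ≠ c → v ∈ Rb)
    (hRc : ∀ u v, u ∈ Rc → H.Adj u v → v ≠ a → v ≠ b → v ≠ c → v ∈ Rc)
    (hsep : ∀ v v', v ∈ Ra → v ∈ Rb → v ∈ Rc → v' ∈ Ra → v' ∈ Rb → v' ∈ Rc → v ≠ a → v ≠ b → v ≠ c →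
      v' ≠ a → v' ≠ b → v' ≠ c → v ≠ v' → 3 ≤ H.degree v → 3 ≤ H.degree v' → ∃ S : Set (Fin n),
        (v ∈ S ∧ b ∉ S ∧ ∀ u x, u ∈ S → H.Adj u x → x ≠ a → x ≠ c → x ≠ v' → x ∈ S) ∨
        (v ∈ S ∧ c ∉ S ∧ ∀ u x, u ∈ S → H.Adj u x → x ≠ a → x ≠ b → x ≠ v' → x ∈ S) ∨
        (v' ∈ S ∧ c ∉ S ∧ ∀ u x, u ∈ S → H.Adj u x → x ≠ a → x ≠ b → x ≠ v → x ∈ S) ∨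
        (v' ∈ S ∧ b ∉ S ∧ ∀ u x, u ∈ S → H.Adj u x → x ≠ a → x ≠ c → x ≠ v → x ∈ S)) :
    (prodBernoulli w).real ((openConn a b)ᶜ ∩ (openConn a c)ᶜ ∩ (openConn b c)ᶜ) ^ 2 ≤
      (prodBernoulli w).real (openConn a b)ᶜ * (prodBernoulli w).real (openConn a c)ᶜ *
        (prodBernoulli w).real (openConn b c)ᶜ :=
  tripleSplit_of_noDoubleClash_pos w a b c fun _ _ hω hη hab hac hbc hbc' =>
    not_doubleClash_of_separated H w hH Ra Rb Rc haR hbR hcR hRa hRb hRc hsep hω hη hab hac hbc hbc'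

/-- **CSQ at `(a; b, c)` when `R_a ∩ R_b ∩ R_c` has at most one branch vertex.** [cite: Gladkov2024, Thm. 4.3, Def. 4.2, Ex. 2.5] -/
theorem clusterSquare_le_sq_of_oneBranch (hH : ∀ u v, u ≠ v → (0 : ℝ) < w s(u, v) → H.Adj u v)
    (Ra Rb Rc : Set (Fin n)) (haR : a ∈ Ra) (hbR : b ∈ Rb) (hcR : c ∈ Rc)
    (hRa : ∀ u v, u ∈ Ra → H.Adj u v → v ≠ a → v ≠ b → v ≠ c → v ∈ Ra)
    (hRb : ∀ u v, u ∈ Rb → H.Adj u v → v ≠ a → v ≠ b → v ≠ c → v ∈ Rb)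
    (hRc : ∀ u v, u ∈ Rc → H.Adj u v → v ≠ a → v ≠ b → v ≠ c → v ∈ Rc)
    (hone : ∀ v v', v ∈ Ra → v ∈ Rb → v ∈ Rc → v' ∈ Ra → v' ∈ Rb → v' ∈ Rc → v ≠ a → v ≠ b → v ≠ c →
      v' ≠ a → v' ≠ b → v' ≠ c → 3 ≤ H.degree v → 3 ≤ H.degree v' → v = v') :
    clusterSquare w a b c ≤ (prodBernoulli w).real (openConn b c)ᶜ ^ 2 :=
  clusterSquare_le_sq_of_noDoubleClash_pos w a b c fun _ _ hω hη hab hac hbc hbc' =>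
    not_doubleClash_of_oneBranch H w hH Ra Rb Rc haR hbR hcR hRa hRb hRc hone hω hη hab hac hbc hbc'

/-- **DUU at `(a; b, c)` when `R_a ∩ R_b ∩ R_c` has at most one branch vertex.** [cite: Gladkov2024, Thm. 5.2 and Thm. 4.3] -/
theorem sq_real_split_le_of_oneBranch (hH : ∀ u v, u ≠ v → (0 : ℝ) < w s(u, v) → H.Adj u v)
    (Ra Rb Rc : Set (Fin n)) (haR : a ∈ Ra) (hbR : b ∈ Rb) (hcR : c ∈ Rc)
    (hRa : ∀ u v, u ∈ Ra → H.Adj u v → v ≠ a → v ≠ b → v ≠ c → v ∈ Ra)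
    (hRb : ∀ u v, u ∈ Rb → H.Adj u v → v ≠ a → v ≠ b → v ≠ c → v ∈ Rb)
    (hRc : ∀ u v, u ∈ Rc → H.Adj u v → v ≠ a → v ≠ b → v ≠ c → v ∈ Rc)
    (hone : ∀ v v', v ∈ Ra → v ∈ Rb → v ∈ Rc → v' ∈ Ra → v' ∈ Rb → v' ∈ Rc → v ≠ a → v ≠ b → v ≠ c →
      v' ≠ a → v' ≠ b → v' ≠ c → 3 ≤ H.degree v → 3 ≤ H.degree v' → v = v') :
    (prodBernoulli w).real ((openConn a b)ᶜ ∩ (openConn a c)ᶜ ∩ (openConn b c)ᶜ) ^ 2 ≤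
      (prodBernoulli w).real ((openConn a b)ᶜ ∩ (openConn a c)ᶜ) * (prodBernoulli w).real (openConn b c)ᶜ ^ 2 :=
  sq_real_split_le_of_noDoubleClash_pos w a b c fun _ _ hω hη hab hac hbc hbc' =>
    not_doubleClash_of_oneBranch H w hH Ra Rb Rc haR hbR hcR hRa hRb hRc hone hω hη hab hac hbc hbc'

/-- **TS for `{a, b, c}` when `R_a ∩ R_b ∩ R_c` has at most one branch vertex.**
[cite: Gladkov2024, Thm. 5.2, Cor. 5.3 (pattern) and Thm. 4.3] -/
theorem tripleSplit_of_oneBranch (hH : ∀ u v, u ≠ v → (0 : ℝ) < w s(u, v) → H.Adj u v)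
    (Ra Rb Rc : Set (Fin n)) (haR : a ∈ Ra) (hbR : b ∈ Rb) (hcR : c ∈ Rc)
    (hRa : ∀ u v, u ∈ Ra → H.Adj u v → v ≠ a → v ≠ b → v ≠ c → v ∈ Ra)
    (hRb : ∀ u v, u ∈ Rb → H.Adj u v → v ≠ a → v ≠ b → v ≠ c → v ∈ Rb)
    (hRc : ∀ u v, u ∈ Rc → H.Adj u v → v ≠ a → v ≠ b → v ≠ c → v ∈ Rc)
    (hone : ∀ v v', v ∈ Ra → v ∈ Rb → v ∈ Rc → v' ∈ Ra → v' ∈ Rb → v' ∈ Rc → v ≠ a → v ≠ b → v ≠ c →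
      v' ≠ a → v' ≠ b → v' ≠ c → 3 ≤ H.degree v → 3 ≤ H.degree v' → v = v') :
    (prodBernoulli w).real ((openConn a b)ᶜ ∩ (openConn a c)ᶜ ∩ (openConn b c)ᶜ) ^ 2 ≤
      (prodBernoulli w).real (openConn a b)ᶜ * (prodBernoulli w).real (openConn a c)ᶜ *
        (prodBernoulli w).real (openConn b c)ᶜ :=
  tripleSplit_of_noDoubleClash_pos w a b c fun _ _ hω hη hab hac hbc hbc' =>
    not_doubleClash_of_oneBranch H w hH Ra Rb Rc haR hbR hcR hRa hRb hRc hone hω hη hab hac hbc hbc'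

/-- **TS for `{a, b, c}` when at most one vertex outside `{a, b, c}` has three or more neighbours** (in a graph `H` carrying all
pairs of positive weight): `μ(a ↮ b, a ↮ c, b ↮ c)² ≤ μ(a ↮ b) μ(a ↮ c) μ(b ↮ c)`.  Contains every weighted graph on at most four
vertices and every graph whose vertices outside `{a, b, c}` have degree ≤ 2. [cite: Gladkov2024, Thm. 5.2, Cor. 5.3 and Thm. 4.3] -/
theorem tripleSplit_of_atMostOneBranch (hH : ∀ u v, u ≠ v → (0 : ℝ) < w s(u, v) → H.Adj u v)
    (hone : ∀ v v', v ≠ a → v ≠ b → v ≠ c → v' ≠ a → v' ≠ b → v' ≠ c → 3 ≤ H.degree v → 3 ≤ H.degree v' → v = v') :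
    (prodBernoulli w).real ((openConn a b)ᶜ ∩ (openConn a c)ᶜ ∩ (openConn b c)ᶜ) ^ 2 ≤
      (prodBernoulli w).real (openConn a b)ᶜ * (prodBernoulli w).real (openConn a c)ᶜ *
        (prodBernoulli w).real (openConn b c)ᶜ :=
  tripleSplit_of_oneBranch w a b c H hH Set.univ Set.univ Set.univ (Set.mem_univ a) (Set.mem_univ b) (Set.mem_univ c)
    (fun _ _ _ _ _ _ _ => Set.mem_univ _) (fun _ _ _ _ _ _ _ => Set.mem_univ _) (fun _ _ _ _ _ _ _ => Set.mem_univ _)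
    fun v v' _ _ _ _ _ _ => hone v v'

/-- **CSQ at `(a; b, c)` when at most one vertex outside `{a, b, c}` has three or more neighbours.**
[cite: Gladkov2024, Thm. 4.3, Def. 4.2, Lemma 3.1, Example 2.5] -/
theorem clusterSquare_le_sq_of_atMostOneBranch (hH : ∀ u v, u ≠ v → (0 : ℝ) < w s(u, v) → H.Adj u v)
    (hone : ∀ v v', v ≠ a → v ≠ b → v ≠ c → v' ≠ a → v' ≠ b → v' ≠ c → 3 ≤ H.degree v → 3 ≤ H.degree v' → v = v') :
    clusterSquare w a b c ≤ (prodBernoulli w).real (openConn b c)ᶜ ^ 2 :=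
  clusterSquare_le_sq_of_oneBranch w a b c H hH Set.univ Set.univ Set.univ (Set.mem_univ a) (Set.mem_univ b) (Set.mem_univ c)
    (fun _ _ _ _ _ _ _ => Set.mem_univ _) (fun _ _ _ _ _ _ _ => Set.mem_univ _) (fun _ _ _ _ _ _ _ => Set.mem_univ _)
    fun v v' _ _ _ _ _ _ => hone v v'

/-- **DUU at `(a; b, c)` when at most one vertex outside `{a, b, c}` has three or more neighbours.**
[cite: Gladkov2024, Thm. 5.2 and Thm. 4.3] -/
theorem sq_real_split_le_of_atMostOneBranch (hH : ∀ u v, u ≠ v → (0 : ℝ) < w s(u, v) → H.Adj u v)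
    (hone : ∀ v v', v ≠ a → v ≠ b → v ≠ c → v' ≠ a → v' ≠ b → v' ≠ c → 3 ≤ H.degree v → 3 ≤ H.degree v' → v = v') :
    (prodBernoulli w).real ((openConn a b)ᶜ ∩ (openConn a c)ᶜ ∩ (openConn b c)ᶜ) ^ 2 ≤
      (prodBernoulli w).real ((openConn a b)ᶜ ∩ (openConn a c)ᶜ) * (prodBernoulli w).real (openConn b c)ᶜ ^ 2 :=
  sq_real_split_le_of_oneBranch w a b c H hH Set.univ Set.univ Set.univ (Set.mem_univ a) (Set.mem_univ b) (Set.mem_univ c)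
    (fun _ _ _ _ _ _ _ => Set.mem_univ _) (fun _ _ _ _ _ _ _ => Set.mem_univ _) (fun _ _ _ _ _ _ _ => Set.mem_univ _)
    fun v v' _ _ _ _ _ _ => hone v v'

end Fin

end Consts

end Summit.CriticalPhenomena.PercolationContinuityZ3.Theorems
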